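import Summits.BirchSwinnertonDyer.BirchSwinnertonDyer.Theses.ResidualThetaTransportAtTwo
import Summits.BirchSwinnertonDyer.BirchSwinnertonDyer.Theorems.ThetaPartnerAtTwoMazurTateCongruenceAtTwoTopOfManinConstant
import Summits.BirchSwinnertonDyer.BirchSwinnertonDyer.Theorems.ResidualThetaTransportAtTwoSignedMuVanishingAtTwoPlusLineV46
import Literature.NumberTheory.EllipticCurves.ModularJacobianTorsionHeckeSelfDualProofs
import HarnessLib

/-!
# Crux Kan⁺ `ThetaLayerLambdaCongruenceAtTwo` (stmt-BirchSwinnertonDyer-20688), line `birth`: the PUB² floor —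
# Kan⁺ BY NAME from {Hecke self-duality of `J₀(N)[ℓ]`, Buzzard 2000 Prop. 2.4} and the node item 27436 `CuspSpanEvenAtTwoOdd`

Cell `bsd-wall`, width seat `bsd-wall-rtt-p3-w3` g9 (`--supports stmt-BirchSwinnertonDyer-20688`; THEOREMS ONLY — no `def`, no
named fact, no `sorry`). BSD is not proved by this; every theorem below is CONDITIONAL on displayed print facts and/or OPEN route items.

STATE OF RECORD BEFORE THIS FILE. The crux is SPLIT (route rev 33) into the print bundle `PublishedInputsHeckeAtTwo` (item 27435,
PUB⁵ = ES ∧ SD ∧ Bz ∧ Se ∧ AU) and the curve-free node `CuspSpanEvenAtTwoOdd` (item 27436, «`CuspSpanEvenAtTwo N` at every odd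
`N`»), with the glue item 27454 `PublishedInputsHeckeAtTwo → CuspSpanEvenAtTwoOdd → ThetaLayerLambdaCongruenceAtTwo` closed
(`ThetaLayerLambdaCongruenceAtTwoGlue_proof`, via `kanP5_of_pub_of_signedMuAnalyticAtTwoPlus` and Abbes–Ullmo). Two landed facts make
three of the five conjuncts idle for Kan⁺:
* tp2-p1-w2 g5, `…ThetaPartnerAtTwoMazurTateCongruenceAtTwoTopOfManinConstant` (p637013):
  `thetaLayerLambdaCongruenceAtTwo_of_sdBz_flatMuZeroAtTwo : SD → Bz → FLAT → Kan⁺` — the assembled Eichler–Shimura fact ES is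
  replaced by the tree theorems `IsNewformOf.exists_maninConstant_ne_zero_holds` / `DepletedLattice.exists_depletedLatticeCurve_isIsogenous`,
  and Serre 1972 (Se) is not used on the plus line;
* rtt-p4 g7, `…ResidualThetaTransportAtTwoSignedMuVanishingAtTwoPlusLineV46`:
  `SignedMuAtTwo.flatMuZeroAtTwo_of_cuspSpanEvenAtTwoOdd : CuspSpanEvenAtTwoOdd → FLAT` — FLAT («`2 ∤ L♭` for every Pollack pair at
  `2`», the COHOMOLOGICALLY normalised statement) follows from the node directly; Abbes–Ullmo Thm A (AU) is needed only to pass to the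
  NÉRON-normalised item 21437 `SignedMuAnalyticAtTwoPlus`, which Kan⁺ does not require.
THIS FILE composes them:
* §1 `thetaLayerLambdaCongruenceAtTwo_of_sdBz_cuspSpanEvenAtTwoOdd : SD → Bz → CuspSpanEvenAtTwoOdd → Kan⁺` (PUB² + node), the curried
  binder list `kanP2_of_pub_of_cuspSpanEvenAtTwoOdd`, and the integral form `…_of_ipBz_cuspSpanEvenAtTwoOdd` in which SD is replaced by the
  Hecke-self-adjoint perfect pairing on `H₁(X₀(N); ℤ)` (`periodHomology_exists_heckeSelfAdjoint_perfectPairing`, through the landed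
  reduction `heckeSelfDual_torsionBy_J0_of_perfectPairing`);
* §2 the same keyed to ROUTE DECLARATIONS only: `…_of_aliasInputs_cuspSpanEvenAtTwoOdd` from the single-fact alias items 27800
  `HeckeSelfDualTorsionJ0Input` · 27798 `BuzzardMultiplicityOneGammaZeroInput` · the node 27436, and `…_of_pub_cuspSpanEvenAtTwoOdd` =
  the glue statement of item 27454 proved using ONLY the conjuncts `.2.1` (SD) and `.2.2.1` (Bz) of item 27435.
PLANNER READING: the print debt of Kan⁺ 20688 relative to the node is PUB² {SD, Bz} (AU, ES, Se idle); with SD ⟸ IP landed, the trust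
base is {intersection pairing on `H₁(X₀(N); ℤ)` twisted by `w_N`, Buzzard 2000 Prop. 2.4} + the node.

References: Greenberg–Vatsal, Invent. Math. 142 (2000) §1 (10), Prop. (2.4) [GreenbergVatsal2000]; R. Pollack, Duke Math. J. 118 (2003)
Conj. 6.3, Prop. 6.18 [Pollack2003]; K. Buzzard, MRL 7 (2000) Prop. 2.4 [Buzzard2000LevelLoweringModTwo]; Darmon–Diamond–Taylor (1995)
§1.6 Lemma 1.38, §4.5 [DarmonDiamondTaylor1995]; L. Merel (1995) §1.2–2.3 [Merel1995Homologie].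
-/

set_option autoImplicit false
-- justification: the `Summit.BirchSwinnertonDyer.BirchSwinnertonDyer.…` path repeats a component (route-file convention)
set_option linter.dupNamespace false

noncomputable section

open Literature.NumberTheory.EllipticCurves.ModularForms
  Summit.BirchSwinnertonDyer.BirchSwinnertonDyer.Theses.ResidualThetaTransportAtTwo

namespace Summit.BirchSwinnertonDyer.BirchSwinnertonDyer.Theorems.ThetaLayerLambdaCongruenceAtTwo

/-! ## §1 Kan⁺ from two print facts and the node -/

/-- **Kan⁺ `ThetaLayerLambdaCongruenceAtTwo` BY NAME from TWO print facts {SD, Bz} and the node item 27436 `CuspSpanEvenAtTwoOdd`.**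
FLAT is obtained from the node in the cohomological normalisation (`SignedMuAtTwo.flatMuZeroAtTwo_of_cuspSpanEvenAtTwoOdd`) and fed to the
ES-free plus line (`thetaLayerLambdaCongruenceAtTwo_of_sdBz_flatMuZeroAtTwo`); Abbes–Ullmo, the assembled Eichler–Shimura fact and Serre
1972 are not used. Conditional on the two print facts and the open node; BSD is not proved by this.
[cite: GreenbergVatsal2000, §1 (10) and Prop. (2.4) (shape)] [cite: Pollack2003, Conj. 6.3 and Prop. 6.18] -/
theorem thetaLayerLambdaCongruenceAtTwo_of_sdBz_cuspSpanEvenAtTwoOdd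
    (hSD : heckeSelfDual_torsionBy_J0) (hBz : buzzard2000_multiplicityOne_gamma0) (hNode : CuspSpanEvenAtTwoOdd) :
    ThetaLayerLambdaCongruenceAtTwo :=
  thetaLayerLambdaCongruenceAtTwo_of_sdBz_flatMuZeroAtTwo hSD hBz
    (Summit.BirchSwinnertonDyer.BirchSwinnertonDyer.Theorems.SignedMuAtTwo.flatMuZeroAtTwo_of_cuspSpanEvenAtTwoOdd hNode)

/-- **Curried binder list «KanP2»**: Hecke self-duality, Buzzard, then the node item 27436, then the crux — all BY NAME.
[cite: Pollack2003, Prop. 6.18 (shape)] -/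
theorem kanP2_of_pub_of_cuspSpanEvenAtTwoOdd :
    heckeSelfDual_torsionBy_J0 → buzzard2000_multiplicityOne_gamma0 → CuspSpanEvenAtTwoOdd → ThetaLayerLambdaCongruenceAtTwo :=
  thetaLayerLambdaCongruenceAtTwo_of_sdBz_cuspSpanEvenAtTwoOdd

/-- **Integral form**: Kan⁺ BY NAME from the Hecke-self-adjoint perfect pairing on the period homology `H₁(X₀(N); ℤ)`
(`periodHomology_exists_heckeSelfAdjoint_perfectPairing` — the `w_N`-twisted intersection pairing), Buzzard 2000 Prop. 2.4 and the
node item 27436; the mod-`ℓ` self-duality SD is DERIVED (`heckeSelfDual_torsionBy_J0_of_perfectPairing`). Conditional; BSD is not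
proved by this. [cite: Merel1995Homologie, §1.2–1.3 and §2.1–2.3] [cite: DarmonDiamondTaylor1995, §1.6 Lemma 1.38 and §4.5] -/
theorem thetaLayerLambdaCongruenceAtTwo_of_ipBz_cuspSpanEvenAtTwoOdd
    (hIP : periodHomology_exists_heckeSelfAdjoint_perfectPairing) (hBz : buzzard2000_multiplicityOne_gamma0)
    (hNode : CuspSpanEvenAtTwoOdd) : ThetaLayerLambdaCongruenceAtTwo :=
  thetaLayerLambdaCongruenceAtTwo_of_sdBz_cuspSpanEvenAtTwoOdd (heckeSelfDual_torsionBy_J0_of_perfectPairing hIP) hBz hNode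

/-! ## §2 The same, keyed to route declarations only -/

/-- **Kan⁺ BY NAME from THREE ROUTE ITEMS**: the single-fact alias items 27800 `HeckeSelfDualTorsionJ0Input` and 27798
`BuzzardMultiplicityOneGammaZeroInput` and the node 27436 `CuspSpanEvenAtTwoOdd` (no bundle). Conditional on two held print facts and
the open node; BSD is not proved by this. [cite: DarmonDiamondTaylor1995, §1.6 Lemma 1.38 and §4.5]
[cite: Buzzard2000LevelLoweringModTwo, Prop. 2.4] -/
theorem thetaLayerLambdaCongruenceAtTwo_of_aliasInputs_cuspSpanEvenAtTwoOdd
    (h27800 : HeckeSelfDualTorsionJ0Input) (h27798 : BuzzardMultiplicityOneGammaZeroInput) (h27436 : CuspSpanEvenAtTwoOdd) :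
    ThetaLayerLambdaCongruenceAtTwo :=
  thetaLayerLambdaCongruenceAtTwo_of_sdBz_cuspSpanEvenAtTwoOdd h27800 h27798 h27436

/-- **The glue statement of item 27454 with three idle conjuncts**: `PublishedInputsHeckeAtTwo → CuspSpanEvenAtTwoOdd →
ThetaLayerLambdaCongruenceAtTwo` proved using ONLY the conjuncts SD (`.2.1`) and Bz (`.2.2.1`) of the PUB⁵ bundle item 27435 — ES
(`.1`), Se (`.2.2.2.1`) and AU (`.2.2.2.2`) are not touched. BSD is not proved by this. [cite: Pollack2003, Prop. 6.18 (shape)] -/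
theorem thetaLayerLambdaCongruenceAtTwo_of_pub_cuspSpanEvenAtTwoOdd (hPUB : PublishedInputsHeckeAtTwo)
    (hNode : CuspSpanEvenAtTwoOdd) : ThetaLayerLambdaCongruenceAtTwo :=
  thetaLayerLambdaCongruenceAtTwo_of_sdBz_cuspSpanEvenAtTwoOdd hPUB.2.1 hPUB.2.2.1 hNode

/-- The glue item 27454's declaration `ThetaLayerLambdaCongruenceAtTwoGlue` re-proved through the PUB² road (a second proof term; the
item is already closed by `ThetaLayerLambdaCongruenceAtTwoGlue_proof`). [cite: Pollack2003, Prop. 6.18 (shape)] -/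
theorem thetaLayerLambdaCongruenceAtTwoGlue_of_sdBz_road : ThetaLayerLambdaCongruenceAtTwoGlue :=
  thetaLayerLambdaCongruenceAtTwo_of_pub_cuspSpanEvenAtTwoOdd

end Summit.BirchSwinnertonDyer.BirchSwinnertonDyer.Theorems.ThetaLayerLambdaCongruenceAtTwo

end
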